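import Mathlib.Analysis.Calculus.MeanValue
import Mathlib.Analysis.Calculus.Deriv.MeanValue
import Mathlib.Analysis.Calculus.ContDiff.Deriv
import Mathlib.Analysis.Calculus.ContDiff.Operations
import Mathlib.Topology.Order.IntermediateValue
import HarnessLib

/-!
# Monotone passages of a `C¹` function through a window of regular values

Topic `Literature/Analysis/Calculus`.  Let `f : ℝ → ℝ` be `C¹` and `[α, β]` (`α < β`) a window of
REGULAR values: `f' t ≠ 0` whenever `f t ∈ [α, β]`.  Then the graph of `f` crosses the horizontal
band `[α, β]` in **passages**: compact parameter intervals `[a, b]` on which `f` is strictly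
monotone from one edge of the window to the other, with `f ∈ (α, β)` exactly on the interior.
PROVED here (elementary real analysis; the form in which "the strands of a diagram cross a thin
ring in radially monotone arcs" is used in knot-diagram arguments):

* `exists_increasing_passage` / `exists_decreasing_passage` — from an ENTRY point `a`
  (`f a = α`, `f' a > 0`, resp. `f a = β`, `f' a < 0`) after which `f` eventually leaves the window,
  there is an exit `b > a`: `f` strictly monotone on `[a, b]` onto `[α, β]`, `f (a, b) ⊆ (α, β)`;
* `exists_passage_of_mem_Ioo` — every parameter `θ` with `f θ ∈ (α, β)`, before and after which
  `f` leaves the window, lies inside such a passage `a < θ < b`;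
* `le_sub_of_passage` — a passage is at least `(β - α)/M` long if `|f'| ≤ M` on it;
* `deriv_pos_of_window`, `strictMonoOn_of_window` — on an interval of window values the derivative keeps its sign.

[folklore]

## References

* W. Rudin, *Principles of Mathematical Analysis*, 3rd ed. (1976), Thm. 5.11/5.12 (monotonicity
  and intermediate values of derivatives). [folklore]
-/

noncomputable section

open Set Filter
open scoped Topology

namespace Literature.Analysis.Calculus

variable {f : ℝ → ℝ} {α β : ℝ}

/-! ## Sign of the derivative along an interval of window values -/

/-- **On an interval where `f` stays in a window of regular values the derivative keeps its sign**
(it is continuous and never zero). [folklore] -/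
theorem deriv_pos_of_window (hf : ContDiff ℝ 1 f) (hreg : ∀ t, f t ∈ Icc α β → deriv f t ≠ 0)
    {a b : ℝ} (hwin : ∀ t ∈ Icc a b, f t ∈ Icc α β) (ha : 0 < deriv f a) :
    ∀ t ∈ Icc a b, 0 < deriv f t := by
  intro t ht
  by_contra hle
  push Not at hle
  -- the continuous `f'` would vanish between `a` and `t`
  have hcont : ContinuousOn (deriv f) (Icc a t) :=
    (ContDiff.continuous_deriv hf le_rfl).continuousOn
  have hmem : (0 : ℝ) ∈ Icc (deriv f t) (deriv f a) := ⟨hle, ha.le⟩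
  obtain ⟨c, hc, hc0⟩ := intermediate_value_Icc' ht.1 hcont hmem
  exact hreg c (hwin c ⟨hc.1, hc.2.trans ht.2⟩) hc0

/-- Hence `f` is strictly increasing on such an interval. [folklore] -/
theorem strictMonoOn_of_window (hf : ContDiff ℝ 1 f) (hreg : ∀ t, f t ∈ Icc α β → deriv f t ≠ 0)
    {a b : ℝ} (hwin : ∀ t ∈ Icc a b, f t ∈ Icc α β) (ha : 0 < deriv f a) :
    StrictMonoOn f (Icc a b) :=
  strictMonoOn_of_deriv_pos (convex_Icc a b) (ContDiff.continuous hf).continuousOn fun t ht ↦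
    deriv_pos_of_window hf hreg hwin ha t (interior_subset ht)

/-! ## Passages -/

/-- **The increasing passage from an entry point.**  If `f a = α`, `f' a > 0` and `f` leaves the
window somewhere after `a`, there is `b > a` with `f b = β`, `f` strictly increasing on `[a, b]`
onto `[α, β]`, and `f (a, b) ⊆ (α, β)`. [folklore] -/
theorem exists_increasing_passage (hf : ContDiff ℝ 1 f) (hαβ : α < β)
    (hreg : ∀ t, f t ∈ Icc α β → deriv f t ≠ 0) {a : ℝ} (ha : f a = α) (ha' : 0 < deriv f a)
    (hexit : ∃ c, a < c ∧ f c ∉ Icc α β) :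
    ∃ b, a < b ∧ f b = β ∧ StrictMonoOn f (Icc a b) ∧ (∀ t ∈ Icc a b, f t ∈ Icc α β) ∧
      (∀ t ∈ Ioo a b, f t ∈ Ioo α β) ∧ SurjOn f (Icc a b) (Icc α β) := by
  obtain ⟨c, hac, hc⟩ := hexit
  -- Step 1: just after `a`, `f ∈ (α, β)`
  obtain ⟨ε, hε, hεwin⟩ : ∃ ε > 0, ∀ t ∈ Ioc a (a + ε), f t ∈ Ioo α β := by
    -- `f' > 0` on a small interval `[a, a + ε₁]` (continuity of `f'`)
    have hdc : ContinuousAt (deriv f) a := (ContDiff.continuous_deriv hf le_rfl).continuousAt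
    obtain ⟨ε₁, hε₁, h₁⟩ : ∃ ε₁ > 0, ∀ t, dist t a < ε₁ → 0 < deriv f t := by
      have h := hdc.eventually (Ioi_mem_nhds ha')
      obtain ⟨ε₁, hε₁, hball⟩ := Metric.eventually_nhds_iff.1 h
      exact ⟨ε₁, hε₁, fun t ht ↦ hball ht⟩
    -- `f < β` on a small interval (continuity of `f`, `f a = α < β`)
    obtain ⟨ε₂, hε₂, h₂⟩ : ∃ ε₂ > 0, ∀ t, dist t a < ε₂ → f t < β := by
      have h := (ContDiff.continuous hf).continuousAt.eventually (Iio_mem_nhds (show f a < β by rw [ha]; exact hαβ))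
      obtain ⟨ε₂, hε₂, hball⟩ := Metric.eventually_nhds_iff.1 h
      exact ⟨ε₂, hε₂, fun t ht ↦ hball ht⟩
    refine ⟨min ε₁ ε₂ / 2, by positivity, fun t ht ↦ ⟨?_, h₂ t ?_⟩⟩
    · -- `f` strictly increasing on `[a, a + ε₁/2]`, so `f t > f a = α`
      have hmono : StrictMonoOn f (Icc a (a + ε₁ / 2)) := by
        refine strictMonoOn_of_deriv_pos (convex_Icc _ _) (ContDiff.continuous hf).continuousOn ?_
        intro s hs
        rw [interior_Icc] at hs
        refine h₁ s ?_
        rw [Real.dist_eq, abs_lt]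
        constructor <;> linarith [hs.1, hs.2]
      have ht' : t ∈ Icc a (a + ε₁ / 2) := ⟨ht.1.le, by
        linarith [ht.2, min_le_left ε₁ ε₂]⟩
      have := hmono ⟨le_rfl, by linarith⟩ ht' ht.1
      rwa [ha] at this
    · rw [Real.dist_eq, abs_lt]
      constructor <;> linarith [ht.1, ht.2, min_le_right ε₁ ε₂]
  -- Step 2: the exit `b = inf {t ≥ a + ε | f t ∉ (α, β)}`
  set S : Set ℝ := {t | a + ε ≤ t ∧ f t ∉ Ioo α β} with hS
  have hcS : c ∈ S := by
    refine ⟨?_, fun h ↦ hc (Ioo_subset_Icc_self h)⟩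
    by_contra hlt
    push Not at hlt
    exact hc (Ioo_subset_Icc_self (hεwin c ⟨hac, hlt.le⟩))
  have hSne : S.Nonempty := ⟨c, hcS⟩
  have hSbdd : BddBelow S := ⟨a + ε, fun t ht ↦ ht.1⟩
  have hSclosed : IsClosed S := by
    have h1 : IsClosed {t : ℝ | a + ε ≤ t} := isClosed_le continuous_const continuous_id
    have h2 : IsClosed {t : ℝ | f t ∉ Ioo α β} := by
      have : {t : ℝ | f t ∉ Ioo α β} = (f ⁻¹' Ioo α β)ᶜ := rfl
      rw [this, isClosed_compl_iff]
      exact isOpen_Ioo.preimage (ContDiff.continuous hf)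
    exact h1.inter h2
  set b := sInf S with hb
  have hbS : b ∈ S := hSclosed.csInf_mem hSne hSbdd
  have hab : a < b := by linarith [hbS.1]
  -- Step 3: on `(a, b)`, `f ∈ (α, β)`
  have hIoo : ∀ t ∈ Ioo a b, f t ∈ Ioo α β := by
    intro t ht
    by_cases hte : t ≤ a + ε
    · exact hεwin t ⟨ht.1, hte⟩
    · push Not at hte
      by_contra hnot
      exact notMem_of_lt_csInf ht.2 hSbdd ⟨hte.le, hnot⟩
  -- Step 4: `f b ∈ [α, β]` by continuity, hence `f b ∈ {α, β}`
  have hbmem : f b ∈ Icc α β := by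
    have hcl : b ∈ closure (Ioo a b) := by
      rw [closure_Ioo hab.ne]; exact right_mem_Icc.2 hab.le
    have himg : f b ∈ closure (f '' Ioo a b) :=
      (ContDiff.continuous hf).continuousWithinAt.mem_closure_image hcl
    have hsub : f '' Ioo a b ⊆ Icc α β := by
      rintro _ ⟨t, ht, rfl⟩; exact Ioo_subset_Icc_self (hIoo t ht)
    exact closure_minimal hsub isClosed_Icc himg
  have hwin : ∀ t ∈ Icc a b, f t ∈ Icc α β := by
    intro t ht
    rcases ht.1.eq_or_lt with h | h
    · rw [← h, ha]; exact left_mem_Icc.2 hαβ.le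
    rcases ht.2.eq_or_lt with h' | h'
    · rw [h']; exact hbmem
    · exact Ioo_subset_Icc_self (hIoo t ⟨h, h'⟩)
  -- Step 5: strict monotonicity on `[a, b]`, so `f b = β`
  have hmono : StrictMonoOn f (Icc a b) := strictMonoOn_of_window hf hreg hwin ha'
  have hfb : f b = β := by
    have hgt : α < f b := by
      rw [← ha]; exact hmono (left_mem_Icc.2 hab.le) (right_mem_Icc.2 hab.le) hab
    rcases hbmem.2.eq_or_lt with h | h
    · exact h
    · exact absurd ⟨hgt, h⟩ hbS.2
  -- Step 6: onto `[α, β]`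
  have hsurj : SurjOn f (Icc a b) (Icc α β) := by
    have h := intermediate_value_Icc hab.le (ContDiff.continuous hf).continuousOn
    rwa [ha, hfb] at h
  exact ⟨b, hab, hfb, hmono, hwin, hIoo, hsurj⟩

/-- **The decreasing passage from an entry point** (`f a = β`, `f' a < 0`). [folklore] -/
theorem exists_decreasing_passage (hf : ContDiff ℝ 1 f) (hαβ : α < β)
    (hreg : ∀ t, f t ∈ Icc α β → deriv f t ≠ 0) {a : ℝ} (ha : f a = β) (ha' : deriv f a < 0)
    (hexit : ∃ c, a < c ∧ f c ∉ Icc α β) :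
    ∃ b, a < b ∧ f b = α ∧ StrictAntiOn f (Icc a b) ∧ (∀ t ∈ Icc a b, f t ∈ Icc α β) ∧
      (∀ t ∈ Ioo a b, f t ∈ Ioo α β) ∧ SurjOn f (Icc a b) (Icc α β) := by
  -- apply the increasing case to `-f` and the window `[-β, -α]`
  have hg : ContDiff ℝ 1 (fun t ↦ -f t) := ContDiff.neg hf
  have hdg : ∀ t, deriv (fun t ↦ -f t) t = -deriv f t := fun t ↦ deriv.neg
  have hreg' : ∀ t, (fun t ↦ -f t) t ∈ Icc (-β) (-α) → deriv (fun t ↦ -f t) t ≠ 0 := by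
    intro t ht
    rw [hdg, neg_ne_zero]
    exact hreg t ⟨by linarith [ht.2], by linarith [ht.1]⟩
  have hexit' : ∃ c, a < c ∧ (fun t ↦ -f t) c ∉ Icc (-β) (-α) := by
    obtain ⟨c, hac, hc⟩ := hexit
    refine ⟨c, hac, fun h ↦ hc ⟨by linarith [h.2], by linarith [h.1]⟩⟩
  obtain ⟨b, hab, hfb, hmono, hwin, hIoo, hsurj⟩ :=
    exists_increasing_passage hg (by linarith : -β < -α) hreg' (by simp [ha]) (by rw [hdg]; linarith)
      hexit'
  refine ⟨b, hab, by simpa using hfb, fun s hs t ht hst ↦ by simpa using hmono hs ht hst,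
    fun t ht ↦ ?_, fun t ht ↦ ?_, fun y hy ↦ ?_⟩
  · have h := hwin t ht
    exact ⟨by linarith [h.2], by linarith [h.1]⟩
  · have h := hIoo t ht
    exact ⟨by linarith [h.2], by linarith [h.1]⟩
  · obtain ⟨t, ht, hft⟩ := hsurj ⟨neg_le_neg hy.2, neg_le_neg hy.1⟩
    exact ⟨t, ht, by simpa using hft⟩

/-- **A passage is long**: if `|f'| ≤ M` on a passage `[a, b]` from one edge of the window to the
other then `b - a ≥ (β - α)/M`. [folklore] -/
theorem le_sub_of_passage (hf : ContDiff ℝ 1 f) {a b M : ℝ} (hab : a < b) (hM : 0 < M)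
    (hbound : ∀ t ∈ Icc a b, |deriv f t| ≤ M) (hends : |f b - f a| = β - α) :
    (β - α) / M ≤ b - a := by
  rw [div_le_iff₀ hM]
  have h := Convex.norm_image_sub_le_of_norm_deriv_le (C := M)
    (fun t _ ↦ (ContDiff.differentiable hf one_ne_zero) t)
    (fun t ht ↦ by rw [Real.norm_eq_abs]; exact hbound t ht) (convex_Icc a b)
    (left_mem_Icc.2 hab.le) (right_mem_Icc.2 hab.le)
  rw [Real.norm_eq_abs, Real.norm_eq_abs, hends, abs_of_pos (sub_pos.2 hab)] at h
  linarith

/-- **Every window value is passed inside a passage.**  If `f θ ∈ (α, β)` and `f` leaves the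
window both before and after `θ`, then `θ` lies in the interior of a passage: `a < θ < b`, `f`
strictly monotone on `[a, b]` with `{f a, f b} = {α, β}`, `f (a, b) ⊆ (α, β)`, onto `[α, β]`.
[folklore] -/
theorem exists_passage_of_mem_Ioo (hf : ContDiff ℝ 1 f) (hαβ : α < β)
    (hreg : ∀ t, f t ∈ Icc α β → deriv f t ≠ 0) {θ : ℝ} (hθ : f θ ∈ Ioo α β)
    (hbefore : ∃ c, c < θ ∧ f c ∉ Icc α β) (hafter : ∃ c, θ < c ∧ f c ∉ Icc α β) :
    ∃ a b, a < θ ∧ θ < b ∧ (∀ t ∈ Icc a b, f t ∈ Icc α β) ∧ (∀ t ∈ Ioo a b, f t ∈ Ioo α β) ∧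
      SurjOn f (Icc a b) (Icc α β) ∧
      ((f a = α ∧ f b = β ∧ StrictMonoOn f (Icc a b)) ∨
        (f a = β ∧ f b = α ∧ StrictAntiOn f (Icc a b))) := by
  -- the last parameter `a < θ` with `f a ∉ (α, β)`
  obtain ⟨c₀, hc₀θ, hc₀⟩ := hbefore
  set T : Set ℝ := {t | t ≤ θ ∧ f t ∉ Ioo α β} with hT
  have hc₀T : c₀ ∈ T := ⟨hc₀θ.le, fun h ↦ hc₀ (Ioo_subset_Icc_self h)⟩
  have hTne : T.Nonempty := ⟨c₀, hc₀T⟩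
  have hTbdd : BddAbove T := ⟨θ, fun t ht ↦ ht.1⟩
  have hTclosed : IsClosed T := by
    have h1 : IsClosed {t : ℝ | t ≤ θ} := isClosed_le continuous_id continuous_const
    have h2 : IsClosed {t : ℝ | f t ∉ Ioo α β} := by
      have : {t : ℝ | f t ∉ Ioo α β} = (f ⁻¹' Ioo α β)ᶜ := rfl
      rw [this, isClosed_compl_iff]
      exact isOpen_Ioo.preimage (ContDiff.continuous hf)
    exact h1.inter h2
  set a := sSup T with ha
  have haT : a ∈ T := hTclosed.csSup_mem hTne hTbdd
  have haθ : a < θ := lt_of_le_of_ne haT.1 fun h ↦ haT.2 (h ▸ hθ)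
  -- on `(a, θ]`, `f ∈ (α, β)`
  have hIoc : ∀ t ∈ Ioc a θ, f t ∈ Ioo α β := by
    intro t ht
    by_contra hnot
    have : t ≤ a := le_csSup hTbdd ⟨ht.2, hnot⟩
    linarith [ht.1]
  -- `f a ∈ [α, β] ∖ (α, β)`
  have hamem : f a ∈ Icc α β := by
    have hcl : a ∈ closure (Ioo a θ) := by
      rw [closure_Ioo haθ.ne]; exact left_mem_Icc.2 haθ.le
    have himg : f a ∈ closure (f '' Ioo a θ) :=
      (ContDiff.continuous hf).continuousWithinAt.mem_closure_image hcl
    have hsub : f '' Ioo a θ ⊆ Icc α β := by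
      rintro _ ⟨t, ht, rfl⟩; exact Ioo_subset_Icc_self (hIoc t ⟨ht.1, ht.2.le⟩)
    exact closure_minimal hsub isClosed_Icc himg
  have hda : deriv f a ≠ 0 := hreg a hamem
  -- the window values on `[a, θ]` force the sign of `f' a` to point inwards
  have hwinaθ : ∀ t ∈ Icc a θ, f t ∈ Icc α β := by
    intro t ht
    rcases ht.1.eq_or_lt with h | h
    · rw [← h]; exact hamem
    · exact Ioo_subset_Icc_self (hIoc t ⟨h, ht.2⟩)
  rcases hamem.1.eq_or_lt with hfa | hfa
  · -- `f a = α`: then `f' a > 0` (else `f` would decrease below `α` just after `a`)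
    have hpos : 0 < deriv f a := by
      rcases hda.lt_or_gt with hneg | hpos
      · exfalso
        -- `f' < 0` on `[a, θ]` (sign is kept), so `f θ < f a = α`
        have hneg' : ∀ t ∈ Icc a θ, 0 < deriv (fun s ↦ -f s) t := by
          have hg : ContDiff ℝ 1 (fun s ↦ -f s) := ContDiff.neg hf
          have hdg : ∀ t, deriv (fun s ↦ -f s) t = -deriv f t := fun t ↦ deriv.neg
          have hreg' : ∀ t, (fun s ↦ -f s) t ∈ Icc (-β) (-α) → deriv (fun s ↦ -f s) t ≠ 0 := by
            intro t ht
            rw [hdg, neg_ne_zero]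
            exact hreg t ⟨by linarith [ht.2], by linarith [ht.1]⟩
          refine deriv_pos_of_window hg hreg' (fun t ht ↦ ?_) (by rw [hdg]; linarith)
          have h := hwinaθ t ht
          exact ⟨by linarith [h.2], by linarith [h.1]⟩
        have hanti : StrictMonoOn (fun s ↦ -f s) (Icc a θ) :=
          strictMonoOn_of_deriv_pos (convex_Icc a θ) (ContDiff.continuous (ContDiff.neg hf)).continuousOn
            fun t ht ↦ hneg' t (interior_subset ht)
        have h := hanti (left_mem_Icc.2 haθ.le) (right_mem_Icc.2 haθ.le) haθ
        simp only [neg_lt_neg_iff] at h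
        linarith [hθ.1, hfa]
      · exact hpos
    obtain ⟨b, hab, hfb, hmono, hwin, hIoo, hsurj⟩ :=
      exists_increasing_passage hf hαβ hreg hfa.symm hpos (hafter.imp fun c hc ↦ ⟨haθ.trans hc.1, hc.2⟩)
    have hθb : θ < b := by
      by_contra hle
      push Not at hle
      rcases hle.eq_or_lt with h | h
      · rw [← h, hfb] at hθ; exact lt_irrefl _ hθ.2
      · have := hIoc b ⟨hab, h.le⟩
        rw [hfb] at this; exact lt_irrefl _ this.2
    exact ⟨a, b, haθ, hθb, hwin, hIoo, hsurj, Or.inl ⟨hfa.symm, hfb, hmono⟩⟩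
  · -- `f a = β` (since `f a ∉ (α, β)` and `α < f a ≤ β`)
    have hfa' : f a = β := by
      rcases hamem.2.eq_or_lt with h | h
      · exact h
      · exact absurd ⟨hfa, h⟩ haT.2
    have hneg : deriv f a < 0 := by
      rcases hda.lt_or_gt with hneg | hpos
      · exact hneg
      · exfalso
        have hmono : StrictMonoOn f (Icc a θ) := strictMonoOn_of_window hf hreg hwinaθ hpos
        have h := hmono (left_mem_Icc.2 haθ.le) (right_mem_Icc.2 haθ.le) haθ
        linarith [hθ.2, hfa']
    obtain ⟨b, hab, hfb, hanti, hwin, hIoo, hsurj⟩ :=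
      exists_decreasing_passage hf hαβ hreg hfa' hneg (hafter.imp fun c hc ↦ ⟨haθ.trans hc.1, hc.2⟩)
    have hθb : θ < b := by
      by_contra hle
      push Not at hle
      rcases hle.eq_or_lt with h | h
      · rw [← h, hfb] at hθ; exact lt_irrefl _ hθ.1
      · have := hIoc b ⟨hab, h.le⟩
        rw [hfb] at this; exact lt_irrefl _ this.1
    exact ⟨a, b, haθ, hθb, hwin, hIoo, hsurj, Or.inr ⟨hfa', hfb, hanti⟩⟩

end Literature.Analysis.Calculus

end
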